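import Summits.AtomisticToContinuum.Crystallization.Theorems.FrustratedLawDichotomyStrainedPatchHomEntryLeafHTSmoke
import Summits.AtomisticToContinuum.Crystallization.Theorems.FrustratedLawDichotomyStrainedPatchHomEntryLeafHTSmokeB

/-!
# KERNEL SMOKE (C): at the corner gate cell the slab leaf REDUCES TO ITS INNER VERDICT — every certificate conjunct of `entryLeafOKHT3 μ pCorner cCorner wGate` holds
# (27623 `(H) HomFloor (1/625)`, hcp half; critic rows 1108 (3) / 1110 (2))

decomp-a2c hand-1 g29 (crux `AperiodicFrustratedLawGap`, stmt-AtomisticToContinuum-27623).  The remaining kernel facts of the certificate side at the gate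
cell (`xiBallOK`, `htROK`, `forceJacCheckN` on the leaf's own far chunks `htFar1`/`htFar2`) and the ASSEMBLY by rewriting (no long `decide`):
★★ `entryLeafOKHT3_corner_eq_inner` — for every `μ`, `entryLeafOKHT3 μ pCorner cCorner wGate = entryLeafOKHCCX μ cCorner (htW pCorner cCorner wGate)`:
the analytic-slab leaf closes the gate cell EXACTLY IF the union verdict of record closes the confined box `ξ_c ± (3.0, 4.0, 1.45)·10⁻³` (scaled widths
`htW`).  (At `t_b` itself no fit verdict can close — the cell sits on the misfit boundary; the inner verdict near the sheet is critic item T3/T4.)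

Kernel facts (`decide +kernel`, each `< 2 min`) + one assembled theorem; 0 sorry; standard axioms.  `--supports stmt-AtomisticToContinuum-27623`.
-/

namespace Summit.AtomisticToContinuum.Crystallization.Theorems.FrustratedLawDichotomyStrainedPatchHomEntryLeafHT

open Literature.Analysis.ValidatedNumerics.Numerics
open Summit.AtomisticToContinuum.Crystallization.Theorems.FrustratedLawDichotomyStrainedPatchHomCurvLJ (cCorner wGate D80 curvCheckLJM)
open Summit.AtomisticToContinuum.Crystallization.Theorems.FrustratedLawDichotomyStrainedPatchHomForceJacN (forceJacCheckN)
open Summit.AtomisticToContinuum.Crystallization.Theorems.FrustratedLawDichotomyStrainedPatchHomForceHcp (xiBallOK)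
open Summit.AtomisticToContinuum.Crystallization.Theorems.FrustratedLawDichotomyStrainedPatchHomCurvLeafHCC (entryLeafOKHCCX)

/-- KERNEL: the gate cell's ξ-box lies in the ball `‖ξ‖ ≤ 1/4`. -/
theorem xiBallOK_corner : xiBallOK cCorner wGate = true := by
  decide +kernel

/-- KERNEL: every straddler of `[−11,11]³` at the gate cell is `≥ 6` from the centre. -/
theorem htROK_corner : htROK cCorner wGate = true := by
  decide +kernel

/-- ★ KERNEL: the sqrt-free far certificate on the leaf's far chunk 1 (`htFar1`, 358 labels) certifies `−SC/100`. -/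
theorem far1_corner_ht : forceJacCheckN cCorner wGate (htFar1 cCorner wGate) (-2814749767106) = true := by
  decide +kernel

/-- ★ KERNEL: the sqrt-free far certificate on the leaf's far chunk 2 (`htFar2`, 396 labels) certifies `−SC/100`. -/
theorem far2_corner_ht : forceJacCheckN cCorner wGate (htFar2 cCorner wGate) (-2814749767106) = true := by
  decide +kernel

/-- The sum of the three certified chunk slope constants is within the payload's `Gs`. [arithmetic on the kernel facts] -/
theorem htGs_sum_corner :
    decide (htGs cCorner wGate (htNear cCorner wGate) + htGs cCorner wGate (htFar1 cCorner wGate) + htGs cCorner wGate (htFar2 cCorner wGate) ≤ pCorner.Gs) =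
      true := by
  have h1 := htSlope_near_corner
  have h2 := htSlope_far1_corner
  have h3 := htSlope_far2_corner
  simp only [Bool.and_eq_true, decide_eq_true_eq] at h1 h2 h3 ⊢
  have e : pCorner.Gs = 2740000000000 := rfl
  rw [e]
  linarith [h1.2, h2.2, h3.2]

/-- ★★ **AT THE GATE CELL THE SLAB LEAF REDUCES TO ITS INNER VERDICT**: every certificate conjunct of `entryLeafOKHT3 μ pCorner cCorner wGate` is `true`,
so the leaf's value is the union verdict of record on the confined box `htW pCorner cCorner wGate`. [assembly of the kernel facts by rewriting] -/
theorem entryLeafOKHT3_corner_eq_inner (μ : ℤ) :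
    entryLeafOKHT3 μ pCorner cCorner wGate = entryLeafOKHCCX μ cCorner (htW pCorner cCorner wGate) := by
  have h1 := htSlope_near_corner
  have h2 := htSlope_far1_corner
  have h3 := htSlope_far2_corner
  simp only [Bool.and_eq_true] at h1 h2 h3
  rw [entryLeafOKHT3, show pCorner.D = D80 from rfl, show pCorner.lam₁ = 140737488355328 from rfl, show pCorner.lam₂ = -2814749767106 from rfl,
    show pCorner.lam₃ = -2814749767106 from rfl, xiBallOK_corner, htROK_corner, htCertOK_corner, curvCheckLJM_corner_ht, far1_corner_ht, far2_corner_ht,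
    h1.1, h2.1, h3.1, htGs_sum_corner]
  simp

end Summit.AtomisticToContinuum.Crystallization.Theorems.FrustratedLawDichotomyStrainedPatchHomEntryLeafHT
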